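import Summits.QuantumFields.YangMills.Theorems.UnitScaleTiltProp7RelPoincareDivBudget
import Summits.QuantumFields.YangMills.Theorems.UnitScaleTiltProp7PointLandauBudget
import HarnessLib

/-!
# Route `UnitScaleTilt`, crux K1 child «MinimiserStabilityRegPr» (stmt-QuantumFields-19200), route-R GROWTH (MAP #3 M10, S3 «nonlinear passage») —
# THE PASSAGE WITH THE DIVERGENCE DISPLAYED AS A BUDGET, part 3∕3: THE (ii′)-SHAPE FOR THE `ℓ²`-OPTIMAL REPRESENTATIVES modulo the curved-N6 structure rows
# (pinned optimum: with a displayed centre debit; unpinned optimum: no debit)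

Cell `ym3-torus`, keyed width hand `ym-routeR-w3` (D-0154 (3c); MAP #3 row M10; LOCATED 2026-08-28 05:10Z on the cell bus).  THEOREMS ONLY (0 `def`, 0 `sorry`);
`--supports stmt-QuantumFields-19200`, count-neutral.  YM₃ on T³ is a ladder rung (R3), not the Clay problem; nothing here claims the stub, the crux, d = 4 or the mass gap.

WHAT.  Part 1∕3 (`Prop7RelPoincareDivBudget.relPoincare_of_divBudget_of_structure_T3`) with `hdivB` DISCHARGED by part 2∕3's point-Landau budgets
(`Prop7PointLandauBudget.sum_hs_divB_le_of_pinnedOpt` ∕ `…_of_optAll`, `δ = 6s²`):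
* ★★ `relPoincare_pinnedOpt_of_centreDebit_of_structure_T3` — `W` `ℓ²`-optimal over the PINNED group (4) (`g↓ = 1`, the registered representative of route-R's stub P), `ζ_C ≥ 0`
  dominating `‖(D^*_{U₀}Y)(x)‖²_HS` at the centres: `((1 − 32c_Eε²)·L^{−2(K−n)} − 442476s² − 13824ε²L^{−4(K−n)})·Σ_b‖Y_b‖² − 18·Σ_xζ_C(x) ≤ 72·Σ_p‖R_p − 1‖² + 384c_Λ·G`;
* ★★ `relPoincare_optAll_of_structure_T3` — `W` `ℓ²`-optimal over its FULL gauge orbit: the same with NO debit.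
NUMBERS.  `442476 = 442368 + 18·6`; at `s = ε₂L^{−(K−n)}`, `a = εL^{−2(K−n)}` the rate is `(1 − 32c_Eε² − 442476ε₂² − 13824ε²L^{−2(K−n)})·L^{−2(K−n)}`, k-UNIFORM.  The centre
debit of the pinned case is genuine (charge modes: `‖D^*Y‖² ≈ q²` at a centre vs gain `0.2527q²·L^{−2(K−n)}`) — it is the pinned ↔ Landau fork (S2″) in passage currency; in the
unpinned case `g↓ ≠ 1` and the fibre identity's coarse pure gauge must be carried by the free Λ∕G letters of the rows.  Neither is decided here; the `Q^{(k)}`-defect (brick (b))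
likewise rides in the free `E`∕Λ letters and is not asserted.

HONEST SCOPE.  Two compositions; everything of content (structure rows, sup radius, centre debit, constraint defect) stays DISPLAYED; nothing of Bałaban's analysis is asserted.

References: T. Bałaban, CMP 99 (1985) 389–434 [Balaban1985BackgroundPropagators] ((3.8) p.392, Thm 3.11 p.416); CMP 102 (1985) 277–309 [Balaban1985Variational] ((4) p.278,
(14) p.280, (22)–(28) pp.281–282, (141)–(143) p.299); CMP 99 (1985) 75–102 [Balaban1985RegularSpaces] ((1.38) p.82).
-/

set_option autoImplicit false

noncomputable section

open scoped BigOperators Matrix.Norms.L2Operator Matrix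

namespace Summit.QuantumFields.YangMills.Theorems.Prop7RelPoincareOptRepr

open Literature.MathematicalPhysics.QuantumFieldTheory.Balaban1983to89
open Literature.MathematicalPhysics.QuantumFieldTheory.Balaban1983to89.T3ContinuumYM3Torus
open Literature.MathematicalPhysics.QuantumFieldTheory.Balaban1983to89.T3PrintedRegularOrbits (descTransf)
open Finset B1RG242Torus
open T4Continuum B15DeterminingSets
open B7Prop1Explicit (treeWord)
open B7Eq78Linearization (conjR)
open B9Eq39Adjoint (curl divB)
open B10Eq27TorusAxialLog (holT unitsField toUField)
open B9TorusCalculus (torusT)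
open BlockAveragingEMLLinearisedBackground (pertVar)
open Summit.QuantumFields.YangMills.Theorems.Prop7RelPoincareDivBudget (relPoincare_of_divBudget_of_structure_T3)
open Summit.QuantumFields.YangMills.Theorems.Prop7PointLandauBudget (sum_hs_divB_le_of_pinnedOpt sum_hs_divB_le_of_optAll)

/-! ## ★★ The passages for the `ℓ²`-optimal representatives -/

/-- ★★ **(ii′)-SHAPE FOR THE PINNED `ℓ²`-OPTIMAL REPRESENTATIVE, MODULO THE STRUCTURE ROWS AND A DISPLAYED CENTRE DEBIT.**  Background `U₀ ∈ SU(2)` with `dist1(U₀(∂p)) ≤ εL^{−2(K−n)}`,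
`216ε ≤ 1`; `W` the `ℓ²`-optimal representative over the PINNED group (4) (`g↓ = 1`) with `‖W_bU₀(b)^* − 1‖ ≤ s ≤ 1`; the curved-N6 structure rows (Λ, E, G, c_Λ, c_E) displayed at
`Y = WU₀^* − 1`; `ζ_C ≥ 0` any site function dominating `‖(D^*_{U₀}Y)(x)‖²_HS` at the `(K−n)`-fold centres.  THEN
`((1 − 32c_Eε²)·L^{−2(K−n)} − 442476s² − 13824ε²L^{−4(K−n)})·Σ_b‖Y_b‖² − 18·Σ_xζ_C(x) ≤ 72·Σ_p‖W(∂p)U₀(∂p)^* − 1‖² + 384c_Λ·G`.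
The centre debit is NOT absorbable in general (charge modes); it is the pinned ↔ Landau fork in passage currency. [cite: Balaban1985BackgroundPropagators, Thm 3.11 p.416;
Balaban1985Variational, (141)-(143) p.299, (4) p.278; Balaban1985RegularSpaces, (1.38) p.82] -/
theorem relPoincare_pinnedOpt_of_centreDebit_of_structure_T3 (F : T3Family) {n K : ℕ} (h : n ≤ K)
    (W U₀ : GaugeField (F.P K) 0 (Matrix.specialUnitaryGroup (Fin 2) ℂ)) {ε s : ℝ} (hε : 0 ≤ ε) (hε1 : 216 * ε ≤ 1)
    (hU₀ : ∀ p : Plaq (F.P K) 0, dist1 (GaugeField.plaqHol U₀ p) ≤ ε * (((F.L : ℝ) ^ (K - n)) ^ 2)⁻¹)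
    (hopt : ∀ v : GaugeTransf (F.P K) 0 (Matrix.specialUnitaryGroup (Fin 2) ℂ), descTransf F n K h v = (fun _ => 1) →
      ∑ b : PBond (F.P K) 0, ‖pertVar U₀ W b‖ ^ 2 ≤ ∑ b : PBond (F.P K) 0, ‖pertVar U₀ (GaugeField.gaugeAct v W) b‖ ^ 2)
    (hδ : ∀ b : PBond (F.P K) 0, ‖(W b : Matrix (Fin 2) (Fin 2) ℂ) * star (U₀ b : Matrix (Fin 2) (Fin 2) ℂ) - 1‖ ≤ s) (hs1 : s ≤ 1)
    (ζ : Site (F.P K) 0 → ℝ) (hζ0 : ∀ x, 0 ≤ ζ x)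
    (hζ : ∀ x : Site (F.P K) 0, (∃ y : Site (F.P K) (K - n), embIter (K - n) y = x) →
      ∑ j : Fin 2, ∑ k : Fin 2, ‖(divB (torusT (F.P K) 0) (fun κ z => unitsField (toUField U₀) ⟨z, κ⟩)
          (fun κ z => (W ⟨z, κ⟩ : Matrix (Fin 2) (Fin 2) ℂ) * star (U₀ ⟨z, κ⟩ : Matrix (Fin 2) (Fin 2) ℂ) - 1) x) j k‖ ^ 2 ≤ ζ x)
    (Λ : Site (F.P K) (K - n) → Matrix (Fin 2) (Fin 2) ℂ) (E : PBond (F.P K) (K - n) → ℝ) {G cΛ cE : ℝ}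
    (hA : ∀ c : PBond (F.P K) (K - n),
      ‖∑ r : Fin (F.P K).d → Fin ((F.P K).L ^ (K - n)), ∑ t ∈ range ((F.P K).L ^ (K - n)),
        conjR (holT (unitsField (toUField U₀)) (Site.fibreSite 0 (K - n) c.src fun _ => ⟨0, pow_pos (F.P K).L_pos (K - n)⟩)
              (treeWord fun ν => ((r ν : ℕ) : ℤ))
            * holT (unitsField (toUField U₀)) (Site.fibreSite 0 (K - n) c.src r) (List.replicate t (c.dir, true)))
          ((W ⟨(fun z : Site (F.P K) 0 => z.shift c.dir)^[t] (Site.fibreSite 0 (K - n) c.src r), c.dir⟩ : Matrix (Fin 2) (Fin 2) ℂ)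
              * star (U₀ ⟨(fun z : Site (F.P K) 0 => z.shift c.dir)^[t] (Site.fibreSite 0 (K - n) c.src r), c.dir⟩ : Matrix (Fin 2) (Fin 2) ℂ) - 1)‖
        ≤ ((F.L : ℝ) ^ (K - n)) ^ 3 * (‖Λ c.tgt‖ + ‖Λ c.src‖) + E c)
    (hΛ : ∑ y : Site (F.P K) (K - n), ‖Λ y‖ ^ 2 ≤ cΛ * (F.L : ℝ) ^ (K - n) * G)
    (hE : ∑ c : PBond (F.P K) (K - n), E c ^ 2 ≤ cE * ((F.L : ℝ) ^ (K - n)) ^ 5 * ε ^ 2 * ∑ b : PBond (F.P K) 0, ‖(W b : Matrix (Fin 2) (Fin 2) ℂ) * star (U₀ b : Matrix (Fin 2) (Fin 2) ℂ) - 1‖ ^ 2) :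
    ((1 - 32 * cE * ε ^ 2) * (((F.L : ℝ) ^ (K - n)) ^ 2)⁻¹ - 442476 * s ^ 2 - 13824 * (ε * (((F.L : ℝ) ^ (K - n)) ^ 2)⁻¹) ^ 2)
        * ∑ b : PBond (F.P K) 0, ‖(W b : Matrix (Fin 2) (Fin 2) ℂ) * star (U₀ b : Matrix (Fin 2) (Fin 2) ℂ) - 1‖ ^ 2 - 18 * ∑ x : Site (F.P K) 0, ζ x
      ≤ 72 * ∑ p : Plaq (F.P K) 0, ‖((GaugeField.plaqHol W p : Matrix.specialUnitaryGroup (Fin 2) ℂ) : Matrix (Fin 2) (Fin 2) ℂ) * star ((GaugeField.plaqHol U₀ p : Matrix.specialUnitaryGroup (Fin 2) ℂ) : Matrix (Fin 2) (Fin 2) ℂ) - 1‖ ^ 2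
        + 384 * cΛ * G := by
  have hbud := sum_hs_divB_le_of_pinnedOpt F h U₀ W hopt hδ ζ hζ0 hζ
  have hP := relPoincare_of_divBudget_of_structure_T3 F n K W U₀ hε hε1 hU₀ hδ hs1 hbud Λ E hA hΛ hE
  have e : ((1 - 32 * cE * ε ^ 2) * (((F.L : ℝ) ^ (K - n)) ^ 2)⁻¹ - 442476 * s ^ 2 - 13824 * (ε * (((F.L : ℝ) ^ (K - n)) ^ 2)⁻¹) ^ 2)
        * ∑ b : PBond (F.P K) 0, ‖(W b : Matrix (Fin 2) (Fin 2) ℂ) * star (U₀ b : Matrix (Fin 2) (Fin 2) ℂ) - 1‖ ^ 2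
      = ((1 - 32 * cE * ε ^ 2) * (((F.L : ℝ) ^ (K - n)) ^ 2)⁻¹ - 18 * (6 * s ^ 2) - 442368 * s ^ 2 - 13824 * (ε * (((F.L : ℝ) ^ (K - n)) ^ 2)⁻¹) ^ 2)
        * ∑ b : PBond (F.P K) 0, ‖(W b : Matrix (Fin 2) (Fin 2) ℂ) * star (U₀ b : Matrix (Fin 2) (Fin 2) ℂ) - 1‖ ^ 2 := by ring
  rw [e]
  exact hP

/-- ★★ **(ii′)-SHAPE FOR THE UNPINNED `ℓ²`-OPTIMAL (COVARIANT-LANDAU) REPRESENTATIVE, MODULO THE STRUCTURE ROWS — NO DEBIT.**  Background `U₀ ∈ SU(2)` with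
`dist1(U₀(∂p)) ≤ εL^{−2(K−n)}`, `216ε ≤ 1`; `W` `ℓ²`-optimal over its FULL gauge orbit relative to `U₀`, `‖W_bU₀(b)^* − 1‖ ≤ s ≤ 1`; structure rows displayed at `Y = WU₀^* − 1`.
THEN `((1 − 32c_Eε²)·L^{−2(K−n)} − 442476s² − 13824ε²L^{−4(K−n)})·Σ_b‖Y_b‖² ≤ 72·Σ_p‖W(∂p)U₀(∂p)^* − 1‖² + 384c_Λ·G` — k-UNIFORM at `s = ε₂L^{−(K−n)}`.  (Here `g↓ ≠ 1` in
general: the fibre identity's coarse pure gauge must be carried by the free Λ∕G letters of the rows — not asserted.) [cite: Balaban1985BackgroundPropagators, Thm 3.11 p.416;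
Balaban1985Variational, (141)-(143) p.299; Balaban1985RegularSpaces, (1.38) p.82] -/
theorem relPoincare_optAll_of_structure_T3 (F : T3Family) (n K : ℕ)
    (W U₀ : GaugeField (F.P K) 0 (Matrix.specialUnitaryGroup (Fin 2) ℂ)) {ε s : ℝ} (hε : 0 ≤ ε) (hε1 : 216 * ε ≤ 1)
    (hU₀ : ∀ p : Plaq (F.P K) 0, dist1 (GaugeField.plaqHol U₀ p) ≤ ε * (((F.L : ℝ) ^ (K - n)) ^ 2)⁻¹)
    (hopt : ∀ v : GaugeTransf (F.P K) 0 (Matrix.specialUnitaryGroup (Fin 2) ℂ),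
      ∑ b : PBond (F.P K) 0, ‖pertVar U₀ W b‖ ^ 2 ≤ ∑ b : PBond (F.P K) 0, ‖pertVar U₀ (GaugeField.gaugeAct v W) b‖ ^ 2)
    (hδ : ∀ b : PBond (F.P K) 0, ‖(W b : Matrix (Fin 2) (Fin 2) ℂ) * star (U₀ b : Matrix (Fin 2) (Fin 2) ℂ) - 1‖ ≤ s) (hs1 : s ≤ 1)
    (Λ : Site (F.P K) (K - n) → Matrix (Fin 2) (Fin 2) ℂ) (E : PBond (F.P K) (K - n) → ℝ) {G cΛ cE : ℝ}
    (hA : ∀ c : PBond (F.P K) (K - n),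
      ‖∑ r : Fin (F.P K).d → Fin ((F.P K).L ^ (K - n)), ∑ t ∈ range ((F.P K).L ^ (K - n)),
        conjR (holT (unitsField (toUField U₀)) (Site.fibreSite 0 (K - n) c.src fun _ => ⟨0, pow_pos (F.P K).L_pos (K - n)⟩)
              (treeWord fun ν => ((r ν : ℕ) : ℤ))
            * holT (unitsField (toUField U₀)) (Site.fibreSite 0 (K - n) c.src r) (List.replicate t (c.dir, true)))
          ((W ⟨(fun z : Site (F.P K) 0 => z.shift c.dir)^[t] (Site.fibreSite 0 (K - n) c.src r), c.dir⟩ : Matrix (Fin 2) (Fin 2) ℂ)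
              * star (U₀ ⟨(fun z : Site (F.P K) 0 => z.shift c.dir)^[t] (Site.fibreSite 0 (K - n) c.src r), c.dir⟩ : Matrix (Fin 2) (Fin 2) ℂ) - 1)‖
        ≤ ((F.L : ℝ) ^ (K - n)) ^ 3 * (‖Λ c.tgt‖ + ‖Λ c.src‖) + E c)
    (hΛ : ∑ y : Site (F.P K) (K - n), ‖Λ y‖ ^ 2 ≤ cΛ * (F.L : ℝ) ^ (K - n) * G)
    (hE : ∑ c : PBond (F.P K) (K - n), E c ^ 2 ≤ cE * ((F.L : ℝ) ^ (K - n)) ^ 5 * ε ^ 2 * ∑ b : PBond (F.P K) 0, ‖(W b : Matrix (Fin 2) (Fin 2) ℂ) * star (U₀ b : Matrix (Fin 2) (Fin 2) ℂ) - 1‖ ^ 2) :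
    ((1 - 32 * cE * ε ^ 2) * (((F.L : ℝ) ^ (K - n)) ^ 2)⁻¹ - 442476 * s ^ 2 - 13824 * (ε * (((F.L : ℝ) ^ (K - n)) ^ 2)⁻¹) ^ 2)
        * ∑ b : PBond (F.P K) 0, ‖(W b : Matrix (Fin 2) (Fin 2) ℂ) * star (U₀ b : Matrix (Fin 2) (Fin 2) ℂ) - 1‖ ^ 2
      ≤ 72 * ∑ p : Plaq (F.P K) 0, ‖((GaugeField.plaqHol W p : Matrix.specialUnitaryGroup (Fin 2) ℂ) : Matrix (Fin 2) (Fin 2) ℂ) * star ((GaugeField.plaqHol U₀ p : Matrix.specialUnitaryGroup (Fin 2) ℂ) : Matrix (Fin 2) (Fin 2) ℂ) - 1‖ ^ 2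
        + 384 * cΛ * G := by
  have hbud0 := sum_hs_divB_le_of_optAll F U₀ W hopt hδ
  have hbud : ∑ x : Site (F.P K) 0, ∑ j : Fin 2, ∑ k : Fin 2,
        ‖(divB (torusT (F.P K) 0) (fun κ z => unitsField (toUField U₀) ⟨z, κ⟩)
          (fun κ z => (W ⟨z, κ⟩ : Matrix (Fin 2) (Fin 2) ℂ) * star (U₀ ⟨z, κ⟩ : Matrix (Fin 2) (Fin 2) ℂ) - 1) x) j k‖ ^ 2
      ≤ 6 * s ^ 2 * ∑ b : PBond (F.P K) 0, ‖(W b : Matrix (Fin 2) (Fin 2) ℂ) * star (U₀ b : Matrix (Fin 2) (Fin 2) ℂ) - 1‖ ^ 2 + 0 := by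
    rw [add_zero]; exact hbud0
  have hP := relPoincare_of_divBudget_of_structure_T3 F n K W U₀ hε hε1 hU₀ hδ hs1 hbud Λ E hA hΛ hE
  have e : ((1 - 32 * cE * ε ^ 2) * (((F.L : ℝ) ^ (K - n)) ^ 2)⁻¹ - 442476 * s ^ 2 - 13824 * (ε * (((F.L : ℝ) ^ (K - n)) ^ 2)⁻¹) ^ 2)
        * ∑ b : PBond (F.P K) 0, ‖(W b : Matrix (Fin 2) (Fin 2) ℂ) * star (U₀ b : Matrix (Fin 2) (Fin 2) ℂ) - 1‖ ^ 2
      = ((1 - 32 * cE * ε ^ 2) * (((F.L : ℝ) ^ (K - n)) ^ 2)⁻¹ - 18 * (6 * s ^ 2) - 442368 * s ^ 2 - 13824 * (ε * (((F.L : ℝ) ^ (K - n)) ^ 2)⁻¹) ^ 2)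
        * ∑ b : PBond (F.P K) 0, ‖(W b : Matrix (Fin 2) (Fin 2) ℂ) * star (U₀ b : Matrix (Fin 2) (Fin 2) ℂ) - 1‖ ^ 2 - 18 * 0 := by ring
  rw [e]
  exact hP


end Summit.QuantumFields.YangMills.Theorems.Prop7RelPoincareOptRepr

end
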